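import Summits.KontsevichZagierPeriods.KontsevichZagierPeriods.Theorems.UnfoldedStokesStokesGenerationFibrewiseRungScalingSwaps
import Summits.KontsevichZagierPeriods.KontsevichZagierPeriods.Theorems.UnfoldedStokesStokesGenerationFibrewiseClosureCongr
import Summits.KontsevichZagierPeriods.KontsevichZagierPeriods.Theorems.UnfoldedStokesStokesGenerationFibrewiseClosureMulFresh

/-!
# `StokesGeneration` (stmt-KontsevichZagierPeriods-3586) — line `fibrewise_stokes`, stub `stub_logTripleProductHomotopy`

Registered rung stub PH3 (rung 24, weight-three log products such as `½ log x · log²(1−x)` and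
`⅙ log³(1−x)`, wave 5) of the line `fibrewise_stokes` of the crux `StokesGeneration` (route
UnfoldedStokes): the generic TRIPLE LOG-PRODUCT HOMOTOPY, the three-family generalisation of the log-pair
homotopy `stub_logPairHomotopy` (rung 20). On the closed cube `[0,1]⁴` (`s = x 0`, `t = x 1`, `u = x 2`,
homotopy parameter `v = x 3`), for three abstract one-dimensional parametric integrands `ℓ₁(s,v)`,
`ℓ₂(t,v)`, `ℓ₃(u,v)` with `v`-derivatives `ℓ₁ᵥ, ℓ₂ᵥ, ℓ₃ᵥ` admitting closed-form primitives `μ₁` (in `s`,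
`∂_s μ₁ = ℓ₁ᵥ`, `μ₁(0,v) = 0`), `μ₂` (in `t`) and `μ₃` (in `u`), all `ℚ`-semialgebraic and continuous on
the closed square, the function
`μ₁(1,v)ℓ₂ℓ₃ + ℓ₁μ₂(1,v)ℓ₃ + ℓ₁ℓ₂μ₃(1,v) − (ℓ₁ℓ₂ℓ₃|_{v=1} − ℓ₁ℓ₂ℓ₃|_{v=0})`
is fibrewise-Stokes decomposable (`FibStokesDecomposable 4`, `Theorems/UnfoldedStokesDefs.lean`).

Proof. Four fibrewise Stokes elements on the same cube, no kink sets, no transcendence input: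
* along `v` (direction `3`) with primitive `G₀ = ℓ₁(s,v) ℓ₂(t,v) ℓ₃(u,v)`, fibre derivative
  `D₀ = ℓ₁ᵥℓ₂ℓ₃ + ℓ₁ℓ₂ᵥℓ₃ + ℓ₁ℓ₂ℓ₃ᵥ` (product rule) and faces `ℓ₁ℓ₂ℓ₃|_{v=1} − ℓ₁ℓ₂ℓ₃|_{v=0}`;
* along `s` (direction `0`) with primitive `G₁ = −μ₁(s,v) ℓ₂ ℓ₃`, fibre derivative `D₁ = −ℓ₁ᵥ ℓ₂ ℓ₃`
  and faces `−μ₁(1,v)ℓ₂ℓ₃ + μ₁(0,v)ℓ₂ℓ₃ = −μ₁(1,v)ℓ₂ℓ₃`;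
* along `t` (direction `1`) with primitive `G₂ = −ℓ₁ μ₂(t,v) ℓ₃`, fibre derivative `D₂ = −ℓ₁ ℓ₂ᵥ ℓ₃`
  and faces `−ℓ₁μ₂(1,v)ℓ₃`;
* along `u` (direction `2`) with primitive `G₃ = −ℓ₁ ℓ₂ μ₃(u,v)`, fibre derivative `D₃ = −ℓ₁ ℓ₂ ℓ₃ᵥ`
  and faces `−ℓ₁ℓ₂μ₃(1,v)`.
Each integrand `Dⱼ − (faces)` is carried by a closed-cube representation (`exists_cubeRep`) and is
decomposable on its own (`fibStokesDecomposable_element`, packaged once in a private single-element lemma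
applied four times); the sum of the four (`fibStokesDecomposable_add`) equals the displayed function at
every point of the cube (`D₀ + D₁ + D₂ + D₃ = 0`), so `fibStokesDecomposable_congr_off_null` with the empty
null set concludes. The two-variable data are read on pairs of cube coordinates through
`isSemialgebraicFunOn_comp_coord`.

References: M. Kontsevich, D. Zagier, *Periods* (2001), §1.2 (rule (3), Newton–Leibniz/Stokes);
D. Zagier, *The dilogarithm function* (2007), §I.2 (functional equations of polylogarithms by
differentiation along a homotopy parameter).
-/

noncomputable section

-- `Summit.KontsevichZagierPeriods.KontsevichZagierPeriods.…` is the tree's mandated layout (single-conjunct summit).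
set_option linter.dupNamespace false

namespace Summit.KontsevichZagierPeriods.KontsevichZagierPeriods.Cruxes.StokesGeneration.FibrewiseStokes

open MeasureTheory Set
open Literature.NumberTheory.Transcendental
open Literature.NumberTheory.Transcendental.KZ
open Literature.ModelTheory.ExponentialFields (IsSemialgebraic)

/-- Reading a two-variable function of the closed unit square on two coordinates `i, k` of the closed unit
cube `[0,1]⁴` preserves `ℚ`-semialgebraicity and continuity. [folklore] -/
private theorem logTriple_read {F : ℝ → ℝ → ℝ}
    (hF : IsSemialgebraicFunOn ℚ (Set.pi Set.univ (fun _ : Fin 2 => Set.Icc (0:ℝ) 1)) (fun z => F (z 0) (z 1)))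
    (hFc : ContinuousOn (fun z : Fin 2 → ℝ => F (z 0) (z 1)) (Set.pi Set.univ (fun _ : Fin 2 => Set.Icc (0:ℝ) 1)))
    (i k : Fin 4) :
    IsSemialgebraicFunOn ℚ (Set.pi Set.univ (fun _ : Fin 4 => Set.Icc (0:ℝ) 1)) (fun x => F (x i) (x k)) ∧
      ContinuousOn (fun x : Fin 4 → ℝ => F (x i) (x k)) (Set.pi Set.univ (fun _ : Fin 4 => Set.Icc (0:ℝ) 1)) := by
  have hS : IsSemialgebraic ℚ (Set.pi Set.univ (fun _ : Fin 4 => Set.Icc (0:ℝ) 1)) := by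
    rw [← cube_eq_pi]; exact isSemialgebraic_cube
  have hmaps : ∀ x ∈ Set.pi Set.univ (fun _ : Fin 4 => Set.Icc (0:ℝ) 1),
      (fun j => x ((![i, k] : Fin 2 → Fin 4) j)) ∈ Set.pi Set.univ (fun _ : Fin 2 => Set.Icc (0:ℝ) 1) :=
    fun x hx => Set.mem_univ_pi.mpr fun j => (Set.mem_univ_pi.mp hx) _
  refine ⟨?_, ?_⟩
  · exact (isSemialgebraicFunOn_comp_coord hF (![i, k] : Fin 2 → Fin 4)).mono (fun x hx => hmaps x hx) hS
  · exact hFc.comp (continuous_pi fun j => continuous_apply ((![i, k] : Fin 2 → Fin 4) j)).continuousOn hmaps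

/-- **One fibrewise Stokes element on the closed cube, packaged.** If `G` and its fibre derivative `D` along
the direction `i` are `ℚ`-semialgebraic and continuous on the closed cube `[0,1]^M` (so `G` is bounded and
the faces `G|_{x_i = t}`, `t ∈ {0, 1}`, are again semialgebraic and continuous), then the Newton–Leibniz
integrand `D − (G|_{x_i = 1} − G|_{x_i = 0})` is fibrewise-Stokes decomposable (one element, empty kink
set, closed-cube representation from `exists_cubeRep`). [cite: KontsevichZagier2001, §1.2 rule (3)] -/
private theorem logTriple_element {M : ℕ} (i : Fin M) {G D : (Fin M → ℝ) → ℝ}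
    (hGsa : IsSemialgebraicFunOn ℚ (Set.pi Set.univ (fun _ : Fin M => Set.Icc (0:ℝ) 1)) G)
    (hDsa : IsSemialgebraicFunOn ℚ (Set.pi Set.univ (fun _ : Fin M => Set.Icc (0:ℝ) 1)) D)
    (hGc : ContinuousOn G (Set.pi Set.univ (fun _ : Fin M => Set.Icc (0:ℝ) 1)))
    (hDc : ContinuousOn D (Set.pi Set.univ (fun _ : Fin M => Set.Icc (0:ℝ) 1)))
    (hder : ∀ x ∈ Set.pi Set.univ (fun _ : Fin M => Set.Icc (0:ℝ) 1), x i ∈ Set.Ioo (0:ℝ) 1 →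
      HasDerivAt (fun s : ℝ => G (Function.update x i s)) (D x) (x i)) :
    FibStokesDecomposable M (fun x => D x - (G (Function.update x i 1) - G (Function.update x i 0))) := by
  classical
  set C : Set (Fin M → ℝ) := Set.pi Set.univ (fun _ : Fin M => Set.Icc (0:ℝ) 1)
  have hCc : IsCompact C := isCompact_univ_pi fun _ => isCompact_Icc
  have hupd : ∀ x ∈ C, ∀ s ∈ Set.Icc (0:ℝ) 1, Function.update x i s ∈ C :=
    fun x hx s hs => update_mem_cubePi hx i hs
  have h0I : (0:ℝ) ∈ Set.Icc (0:ℝ) 1 := ⟨le_rfl, zero_le_one⟩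
  have h1I : (1:ℝ) ∈ Set.Icc (0:ℝ) 1 := ⟨zero_le_one, le_rfl⟩
  -- composition with the (semialgebraic, continuous) face maps `x ↦ x[i ↦ t]`, `t ∈ {0, 1}`
  have hface_sa : ∀ (t : ℝ), IsAlgebraic ℚ t → t ∈ Set.Icc (0:ℝ) 1 →
      IsSemialgebraicFunOn ℚ C (fun x => G (Function.update x i t)) :=
    fun t ht htI => IsSemialgebraicFunOn.comp_isSemialgebraicMapOn_holds hGsa
      (isSemialgebraicMapOn_update_const i ht) fun x hx => hupd x hx t htI
  have hface_c : ∀ (t : ℝ), t ∈ Set.Icc (0:ℝ) 1 → ContinuousOn (fun x => G (Function.update x i t)) C :=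
    fun t htI => hGc.comp (continuous_id.update i continuous_const).continuousOn fun x hx => hupd x hx t htI
  have hcu : ∀ x : Fin M → ℝ, Continuous fun s : ℝ => Function.update x i s :=
    fun x => continuous_const.update i continuous_id
  -- the integrand and its closed-cube representation
  obtain ⟨I, hI⟩ : ∃ I : (Fin M → ℝ) → ℝ,
      I = fun x => D x - (G (Function.update x i 1) - G (Function.update x i 0)) := ⟨_, rfl⟩
  have hIsa : IsSemialgebraicFunOn ℚ C I := by
    rw [hI]; exact hDsa.fun_sub ((hface_sa 1 isAlgebraic_one h1I).fun_sub (hface_sa 0 isAlgebraic_zero h0I))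
  have hIc : ContinuousOn I C := by
    rw [hI]; exact hDc.sub ((hface_c 1 h1I).sub (hface_c 0 h0I))
  obtain ⟨q, hqd, hqi⟩ := exists_cubeRep M I hIsa hIc
  obtain ⟨B, hB⟩ := hCc.exists_bound_of_continuousOn hGc
  -- one element, empty kink set
  have hdec : FibStokesDecomposable M q.integrand :=
    fibStokesDecomposable_element M i G D ∅ q hGsa hDsa
      Literature.ModelTheory.ExponentialFields.isSemialgebraic_empty
      ⟨B, fun x hx => by simpa [Real.norm_eq_abs] using hB x hx⟩
      (fun x _ => by simp only [Set.mem_empty_iff_false, Set.setOf_false, Set.finite_empty])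
      (fun x hx => hGc.comp (hcu x).continuousOn fun s hs => hupd x hx s hs)
      (fun x hx _ hxi => hder x hx hxi) hqd (fun x _ => by rw [hqi, hI])
  rw [hqi, hI] at hdec
  exact hdec

/-- **Registered stub `stub_logTripleProductHomotopy` (rung 24, PH3): the triple log-product homotopy.**
On `[0,1]⁴` (`s = x 0`, `t = x 1`, `u = x 2`, `v = x 3`) the four elements
`E_v[G = ℓ₁(s,v)ℓ₂(t,v)ℓ₃(u,v)]`, `E_s[G = −μ₁(s,v)ℓ₂ℓ₃]`, `E_t[G = −ℓ₁μ₂(t,v)ℓ₃]`,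
`E_u[G = −ℓ₁ℓ₂μ₃(u,v)]` certify
`μ₁(1,v)ℓ₂ℓ₃ + ℓ₁μ₂(1,v)ℓ₃ + ℓ₁ℓ₂μ₃(1,v) − (ℓ₁ℓ₂ℓ₃|_{v=1} − ℓ₁ℓ₂ℓ₃|_{v=0}) ∈ Dec` for abstract
`ℚ`-semialgebraic continuous `ℓₖ, ℓₖᵥ = ∂_vℓₖ, μₖ = ∫₀ ℓₖᵥ` (`k = 1, 2, 3`) on the closed square.
[cite: KontsevichZagier2001, §1.2 rule (3)] -/
theorem stub_logTripleProductHomotopy (ℓ₁ ℓ₁ᵥ μ₁ ℓ₂ ℓ₂ᵥ μ₂ ℓ₃ ℓ₃ᵥ μ₃ : ℝ → ℝ → ℝ)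
    (hℓ₁ : IsSemialgebraicFunOn ℚ (Set.pi Set.univ (fun _ : Fin 2 => Set.Icc (0:ℝ) 1)) (fun z => ℓ₁ (z 0) (z 1)))
    (hℓ₁ᵥ : IsSemialgebraicFunOn ℚ (Set.pi Set.univ (fun _ : Fin 2 => Set.Icc (0:ℝ) 1)) (fun z => ℓ₁ᵥ (z 0) (z 1)))
    (hμ₁ : IsSemialgebraicFunOn ℚ (Set.pi Set.univ (fun _ : Fin 2 => Set.Icc (0:ℝ) 1)) (fun z => μ₁ (z 0) (z 1)))
    (hℓ₂ : IsSemialgebraicFunOn ℚ (Set.pi Set.univ (fun _ : Fin 2 => Set.Icc (0:ℝ) 1)) (fun z => ℓ₂ (z 0) (z 1)))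
    (hℓ₂ᵥ : IsSemialgebraicFunOn ℚ (Set.pi Set.univ (fun _ : Fin 2 => Set.Icc (0:ℝ) 1)) (fun z => ℓ₂ᵥ (z 0) (z 1)))
    (hμ₂ : IsSemialgebraicFunOn ℚ (Set.pi Set.univ (fun _ : Fin 2 => Set.Icc (0:ℝ) 1)) (fun z => μ₂ (z 0) (z 1)))
    (hℓ₃ : IsSemialgebraicFunOn ℚ (Set.pi Set.univ (fun _ : Fin 2 => Set.Icc (0:ℝ) 1)) (fun z => ℓ₃ (z 0) (z 1)))
    (hℓ₃ᵥ : IsSemialgebraicFunOn ℚ (Set.pi Set.univ (fun _ : Fin 2 => Set.Icc (0:ℝ) 1)) (fun z => ℓ₃ᵥ (z 0) (z 1)))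
    (hμ₃ : IsSemialgebraicFunOn ℚ (Set.pi Set.univ (fun _ : Fin 2 => Set.Icc (0:ℝ) 1)) (fun z => μ₃ (z 0) (z 1)))
    (hℓ₁c : ContinuousOn (fun z : Fin 2 → ℝ => ℓ₁ (z 0) (z 1)) (Set.pi Set.univ (fun _ : Fin 2 => Set.Icc (0:ℝ) 1)))
    (hℓ₁ᵥc : ContinuousOn (fun z : Fin 2 → ℝ => ℓ₁ᵥ (z 0) (z 1)) (Set.pi Set.univ (fun _ : Fin 2 => Set.Icc (0:ℝ) 1)))
    (hμ₁c : ContinuousOn (fun z : Fin 2 → ℝ => μ₁ (z 0) (z 1)) (Set.pi Set.univ (fun _ : Fin 2 => Set.Icc (0:ℝ) 1)))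
    (hℓ₂c : ContinuousOn (fun z : Fin 2 → ℝ => ℓ₂ (z 0) (z 1)) (Set.pi Set.univ (fun _ : Fin 2 => Set.Icc (0:ℝ) 1)))
    (hℓ₂ᵥc : ContinuousOn (fun z : Fin 2 → ℝ => ℓ₂ᵥ (z 0) (z 1)) (Set.pi Set.univ (fun _ : Fin 2 => Set.Icc (0:ℝ) 1)))
    (hμ₂c : ContinuousOn (fun z : Fin 2 → ℝ => μ₂ (z 0) (z 1)) (Set.pi Set.univ (fun _ : Fin 2 => Set.Icc (0:ℝ) 1)))
    (hℓ₃c : ContinuousOn (fun z : Fin 2 → ℝ => ℓ₃ (z 0) (z 1)) (Set.pi Set.univ (fun _ : Fin 2 => Set.Icc (0:ℝ) 1)))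
    (hℓ₃ᵥc : ContinuousOn (fun z : Fin 2 → ℝ => ℓ₃ᵥ (z 0) (z 1)) (Set.pi Set.univ (fun _ : Fin 2 => Set.Icc (0:ℝ) 1)))
    (hμ₃c : ContinuousOn (fun z : Fin 2 → ℝ => μ₃ (z 0) (z 1)) (Set.pi Set.univ (fun _ : Fin 2 => Set.Icc (0:ℝ) 1)))
    (hdv₁ : ∀ s ∈ Set.Icc (0:ℝ) 1, ∀ v ∈ Set.Ioo (0:ℝ) 1, HasDerivAt (fun r => ℓ₁ s r) (ℓ₁ᵥ s v) v)
    (hds₁ : ∀ v ∈ Set.Icc (0:ℝ) 1, ∀ s ∈ Set.Ioo (0:ℝ) 1, HasDerivAt (fun r => μ₁ r v) (ℓ₁ᵥ s v) s)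
    (hμ₁0 : ∀ v ∈ Set.Icc (0:ℝ) 1, μ₁ 0 v = 0)
    (hdv₂ : ∀ s ∈ Set.Icc (0:ℝ) 1, ∀ v ∈ Set.Ioo (0:ℝ) 1, HasDerivAt (fun r => ℓ₂ s r) (ℓ₂ᵥ s v) v)
    (hds₂ : ∀ v ∈ Set.Icc (0:ℝ) 1, ∀ s ∈ Set.Ioo (0:ℝ) 1, HasDerivAt (fun r => μ₂ r v) (ℓ₂ᵥ s v) s)
    (hμ₂0 : ∀ v ∈ Set.Icc (0:ℝ) 1, μ₂ 0 v = 0)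
    (hdv₃ : ∀ s ∈ Set.Icc (0:ℝ) 1, ∀ v ∈ Set.Ioo (0:ℝ) 1, HasDerivAt (fun r => ℓ₃ s r) (ℓ₃ᵥ s v) v)
    (hds₃ : ∀ v ∈ Set.Icc (0:ℝ) 1, ∀ s ∈ Set.Ioo (0:ℝ) 1, HasDerivAt (fun r => μ₃ r v) (ℓ₃ᵥ s v) s)
    (hμ₃0 : ∀ v ∈ Set.Icc (0:ℝ) 1, μ₃ 0 v = 0) :
    FibStokesDecomposable 4 (fun x =>
      μ₁ 1 (x 3) * ℓ₂ (x 1) (x 3) * ℓ₃ (x 2) (x 3) + ℓ₁ (x 0) (x 3) * μ₂ 1 (x 3) * ℓ₃ (x 2) (x 3) +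
          ℓ₁ (x 0) (x 3) * ℓ₂ (x 1) (x 3) * μ₃ 1 (x 3) -
        (ℓ₁ (x 0) 1 * ℓ₂ (x 1) 1 * ℓ₃ (x 2) 1 - ℓ₁ (x 0) 0 * ℓ₂ (x 1) 0 * ℓ₃ (x 2) 0)) := by
  classical
  -- the two-variable data read on pairs of cube coordinates: family `k + 1` on `(x k, x 3)`, `k = 0, 1, 2`
  obtain ⟨hA1sa, hA1c⟩ := logTriple_read hℓ₁ hℓ₁c 0 3
  obtain ⟨hA2sa, hA2c⟩ := logTriple_read hℓ₂ hℓ₂c 1 3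
  obtain ⟨hA3sa, hA3c⟩ := logTriple_read hℓ₃ hℓ₃c 2 3
  obtain ⟨hV1sa, hV1c⟩ := logTriple_read hℓ₁ᵥ hℓ₁ᵥc 0 3
  obtain ⟨hV2sa, hV2c⟩ := logTriple_read hℓ₂ᵥ hℓ₂ᵥc 1 3
  obtain ⟨hV3sa, hV3c⟩ := logTriple_read hℓ₃ᵥ hℓ₃ᵥc 2 3
  obtain ⟨hM1sa, hM1c⟩ := logTriple_read hμ₁ hμ₁c 0 3
  obtain ⟨hM2sa, hM2c⟩ := logTriple_read hμ₂ hμ₂c 1 3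
  obtain ⟨hM3sa, hM3c⟩ := logTriple_read hμ₃ hμ₃c 2 3
  set C : Set (Fin 4 → ℝ) := Set.pi Set.univ (fun _ : Fin 4 => Set.Icc (0:ℝ) 1)
  have hmem : ∀ x ∈ C, ∀ i, x i ∈ Set.Icc (0:ℝ) 1 := fun x hx i => (Set.mem_univ_pi.mp hx) i
  have h03 : (0 : Fin 4) ≠ 3 := by decide
  have h13 : (1 : Fin 4) ≠ 3 := by decide
  have h23 : (2 : Fin 4) ≠ 3 := by decide
  have h10 : (1 : Fin 4) ≠ 0 := by decide
  have h20 : (2 : Fin 4) ≠ 0 := by decide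
  have h30 : (3 : Fin 4) ≠ 0 := by decide
  have h01 : (0 : Fin 4) ≠ 1 := by decide
  have h21 : (2 : Fin 4) ≠ 1 := by decide
  have h31 : (3 : Fin 4) ≠ 1 := by decide
  have h02 : (0 : Fin 4) ≠ 2 := by decide
  have h12 : (1 : Fin 4) ≠ 2 := by decide
  have h32 : (3 : Fin 4) ≠ 2 := by decide
  -- the witnesses: primitives `Gⱼ` and fibre derivatives `Dⱼ`
  obtain ⟨G0, hG0⟩ : ∃ G0 : (Fin 4 → ℝ) → ℝ,
      G0 = fun x => ℓ₁ (x 0) (x 3) * ℓ₂ (x 1) (x 3) * ℓ₃ (x 2) (x 3) := ⟨_, rfl⟩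
  obtain ⟨D0, hD0⟩ : ∃ D0 : (Fin 4 → ℝ) → ℝ,
      D0 = fun x => (ℓ₁ᵥ (x 0) (x 3) * ℓ₂ (x 1) (x 3) + ℓ₁ (x 0) (x 3) * ℓ₂ᵥ (x 1) (x 3)) * ℓ₃ (x 2) (x 3) +
        ℓ₁ (x 0) (x 3) * ℓ₂ (x 1) (x 3) * ℓ₃ᵥ (x 2) (x 3) := ⟨_, rfl⟩
  obtain ⟨G1, hG1⟩ : ∃ G1 : (Fin 4 → ℝ) → ℝ,
      G1 = fun x => -(μ₁ (x 0) (x 3) * ℓ₂ (x 1) (x 3) * ℓ₃ (x 2) (x 3)) := ⟨_, rfl⟩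
  obtain ⟨D1, hD1⟩ : ∃ D1 : (Fin 4 → ℝ) → ℝ,
      D1 = fun x => -(ℓ₁ᵥ (x 0) (x 3) * ℓ₂ (x 1) (x 3) * ℓ₃ (x 2) (x 3)) := ⟨_, rfl⟩
  obtain ⟨G2, hG2⟩ : ∃ G2 : (Fin 4 → ℝ) → ℝ,
      G2 = fun x => -(ℓ₁ (x 0) (x 3) * μ₂ (x 1) (x 3) * ℓ₃ (x 2) (x 3)) := ⟨_, rfl⟩
  obtain ⟨D2, hD2⟩ : ∃ D2 : (Fin 4 → ℝ) → ℝ,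
      D2 = fun x => -(ℓ₁ (x 0) (x 3) * ℓ₂ᵥ (x 1) (x 3) * ℓ₃ (x 2) (x 3)) := ⟨_, rfl⟩
  obtain ⟨G3, hG3⟩ : ∃ G3 : (Fin 4 → ℝ) → ℝ,
      G3 = fun x => -(ℓ₁ (x 0) (x 3) * ℓ₂ (x 1) (x 3) * μ₃ (x 2) (x 3)) := ⟨_, rfl⟩
  obtain ⟨D3, hD3⟩ : ∃ D3 : (Fin 4 → ℝ) → ℝ,
      D3 = fun x => -(ℓ₁ (x 0) (x 3) * ℓ₂ (x 1) (x 3) * ℓ₃ᵥ (x 2) (x 3)) := ⟨_, rfl⟩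
  have hG0sa : IsSemialgebraicFunOn ℚ C G0 := by rw [hG0]; exact (hA1sa.fun_mul hA2sa).fun_mul hA3sa
  have hD0sa : IsSemialgebraicFunOn ℚ C D0 := by
    rw [hD0]
    exact (((hV1sa.fun_mul hA2sa).fun_add (hA1sa.fun_mul hV2sa)).fun_mul hA3sa).fun_add
      ((hA1sa.fun_mul hA2sa).fun_mul hV3sa)
  have hG1sa : IsSemialgebraicFunOn ℚ C G1 := by rw [hG1]; exact ((hM1sa.fun_mul hA2sa).fun_mul hA3sa).fun_neg
  have hD1sa : IsSemialgebraicFunOn ℚ C D1 := by rw [hD1]; exact ((hV1sa.fun_mul hA2sa).fun_mul hA3sa).fun_neg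
  have hG2sa : IsSemialgebraicFunOn ℚ C G2 := by rw [hG2]; exact ((hA1sa.fun_mul hM2sa).fun_mul hA3sa).fun_neg
  have hD2sa : IsSemialgebraicFunOn ℚ C D2 := by rw [hD2]; exact ((hA1sa.fun_mul hV2sa).fun_mul hA3sa).fun_neg
  have hG3sa : IsSemialgebraicFunOn ℚ C G3 := by rw [hG3]; exact ((hA1sa.fun_mul hA2sa).fun_mul hM3sa).fun_neg
  have hD3sa : IsSemialgebraicFunOn ℚ C D3 := by rw [hD3]; exact ((hA1sa.fun_mul hA2sa).fun_mul hV3sa).fun_neg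
  have hG0c : ContinuousOn G0 C := by rw [hG0]; exact (hA1c.mul hA2c).mul hA3c
  have hD0c : ContinuousOn D0 C := by
    rw [hD0]; exact (((hV1c.mul hA2c).add (hA1c.mul hV2c)).mul hA3c).add ((hA1c.mul hA2c).mul hV3c)
  have hG1c : ContinuousOn G1 C := by rw [hG1]; exact ((hM1c.mul hA2c).mul hA3c).neg
  have hD1c : ContinuousOn D1 C := by rw [hD1]; exact ((hV1c.mul hA2c).mul hA3c).neg
  have hG2c : ContinuousOn G2 C := by rw [hG2]; exact ((hA1c.mul hM2c).mul hA3c).neg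
  have hD2c : ContinuousOn D2 C := by rw [hD2]; exact ((hA1c.mul hV2c).mul hA3c).neg
  have hG3c : ContinuousOn G3 C := by rw [hG3]; exact ((hA1c.mul hA2c).mul hM3c).neg
  have hD3c : ContinuousOn D3 C := by rw [hD3]; exact ((hA1c.mul hA2c).mul hV3c).neg
  -- the four elements: fibre derivatives by the product rule
  have hE0 := logTriple_element 3 hG0sa hD0sa hG0c hD0c fun x hx hx3 => by
    have hfun : (fun s : ℝ => G0 (Function.update x 3 s)) = fun s => ℓ₁ (x 0) s * ℓ₂ (x 1) s * ℓ₃ (x 2) s := by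
      funext s; rw [hG0]
      simp only [Function.update_self, Function.update_of_ne h03, Function.update_of_ne h13,
        Function.update_of_ne h23]
    rw [hfun, hD0]
    exact ((hdv₁ (x 0) (hmem x hx 0) (x 3) hx3).mul (hdv₂ (x 1) (hmem x hx 1) (x 3) hx3)).mul
      (hdv₃ (x 2) (hmem x hx 2) (x 3) hx3)
  have hE1 := logTriple_element 0 hG1sa hD1sa hG1c hD1c fun x hx hx0 => by
    have hfun : (fun s : ℝ => G1 (Function.update x 0 s)) =
        fun s => -(μ₁ s (x 3) * ℓ₂ (x 1) (x 3) * ℓ₃ (x 2) (x 3)) := by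
      funext s; rw [hG1]
      simp only [Function.update_self, Function.update_of_ne h10, Function.update_of_ne h20,
        Function.update_of_ne h30]
    rw [hfun, hD1]
    exact (((hds₁ (x 3) (hmem x hx 3) (x 0) hx0).mul_const (ℓ₂ (x 1) (x 3))).mul_const (ℓ₃ (x 2) (x 3))).neg
  have hE2 := logTriple_element 1 hG2sa hD2sa hG2c hD2c fun x hx hx1 => by
    have hfun : (fun s : ℝ => G2 (Function.update x 1 s)) =
        fun s => -(ℓ₁ (x 0) (x 3) * μ₂ s (x 3) * ℓ₃ (x 2) (x 3)) := by
      funext s; rw [hG2]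
      simp only [Function.update_self, Function.update_of_ne h01, Function.update_of_ne h21,
        Function.update_of_ne h31]
    rw [hfun, hD2]
    exact (((hds₂ (x 3) (hmem x hx 3) (x 1) hx1).const_mul (ℓ₁ (x 0) (x 3))).mul_const (ℓ₃ (x 2) (x 3))).neg
  have hE3 := logTriple_element 2 hG3sa hD3sa hG3c hD3c fun x hx hx2 => by
    have hfun : (fun s : ℝ => G3 (Function.update x 2 s)) =
        fun s => -(ℓ₁ (x 0) (x 3) * ℓ₂ (x 1) (x 3) * μ₃ s (x 3)) := by
      funext s; rw [hG3]
      simp only [Function.update_self, Function.update_of_ne h02, Function.update_of_ne h12,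
        Function.update_of_ne h32]
    rw [hfun, hD3]
    exact ((hds₃ (x 3) (hmem x hx 3) (x 2) hx2).const_mul (ℓ₁ (x 0) (x 3) * ℓ₂ (x 1) (x 3))).neg
  -- their sum is decomposable
  have hsum := fibStokesDecomposable_add 4 _ _
    (fibStokesDecomposable_add 4 _ _ (fibStokesDecomposable_add 4 _ _ hE0 hE1) hE2) hE3
  -- the pointwise identity on the cube
  refine fibStokesDecomposable_congr_off_null 4 _ _ ∅
    Literature.ModelTheory.ExponentialFields.isSemialgebraic_empty measure_empty (fun x hx _ => ?_) hsum
  have hface0 : G0 (Function.update x 3 1) - G0 (Function.update x 3 0) =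
      ℓ₁ (x 0) 1 * ℓ₂ (x 1) 1 * ℓ₃ (x 2) 1 - ℓ₁ (x 0) 0 * ℓ₂ (x 1) 0 * ℓ₃ (x 2) 0 := by
    rw [hG0]
    simp only [Function.update_self, Function.update_of_ne h03, Function.update_of_ne h13,
      Function.update_of_ne h23]
  have hface1 : G1 (Function.update x 0 1) - G1 (Function.update x 0 0) =
      -(μ₁ 1 (x 3) * ℓ₂ (x 1) (x 3) * ℓ₃ (x 2) (x 3)) := by
    rw [hG1]
    simp only [Function.update_self, Function.update_of_ne h10, Function.update_of_ne h20,
      Function.update_of_ne h30, hμ₁0 (x 3) (hmem x hx 3), zero_mul, neg_zero, sub_zero]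
  have hface2 : G2 (Function.update x 1 1) - G2 (Function.update x 1 0) =
      -(ℓ₁ (x 0) (x 3) * μ₂ 1 (x 3) * ℓ₃ (x 2) (x 3)) := by
    rw [hG2]
    simp only [Function.update_self, Function.update_of_ne h01, Function.update_of_ne h21,
      Function.update_of_ne h31, hμ₂0 (x 3) (hmem x hx 3), mul_zero, zero_mul, neg_zero, sub_zero]
  have hface3 : G3 (Function.update x 2 1) - G3 (Function.update x 2 0) =
      -(ℓ₁ (x 0) (x 3) * ℓ₂ (x 1) (x 3) * μ₃ 1 (x 3)) := by
    rw [hG3]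
    simp only [Function.update_self, Function.update_of_ne h02, Function.update_of_ne h12,
      Function.update_of_ne h32, hμ₃0 (x 3) (hmem x hx 3), mul_zero, neg_zero, sub_zero]
  simp only [hface0, hface1, hface2, hface3, hD0, hD1, hD2, hD3]
  ring

end Summit.KontsevichZagierPeriods.KontsevichZagierPeriods.Cruxes.StokesGeneration.FibrewiseStokes

end
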